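import Summits.CriticalPhenomena.PercolationContinuityZ3.Theorems.Transplant.SkelPhiParaRunFineBox
import Summits.CriticalPhenomena.PercolationContinuityZ3.Theorems.Transplant.SkelPhiParaCoarseV
import Summits.CriticalPhenomena.PercolationContinuityZ3.Theorems.Transplant.PlanarCells2Levels
import HarnessLib

/-!
# N1 (the `{±1}` node), (C) column file (C-A2): THE FOOTPRINT ROOMS OF THE RUN-FRAME SEGMENT — (§1) the three PLANAR level-form rooms of a corridor
# `y → y + du` of the two-unit cells (`z ∈ P.Q y ∪ P.Hfull y du` from `−5r∥ ≤ lev ≤ 22r∥`, `|z⊥ − cen⊥| ≤ 2r⊥`; `z ∈ P.Hfull y du`; the unit box of `z`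
# inside `P.M (y+du)` from `17r∥ + 1 ≤ lev ≤ 23r∥ − 1`, `|z⊥ − cen⊥| ≤ 3r⊥ − 1`), and (§2) the SIGNED off-centre reading of a run box into the fine
# cell map (`fine_sub_bounds_of_runX_mem_Icc_signed`: the `max/min (vα·b)` numerators of (C-N3), so that the drift `k·v` of a v-band's `α`-window and
# the advance `k·nℓ` of its `β′`-window CANCEL in `m·α − vα·β′` — the crude `|vα|·B` form of `SkelPhiParaRunFineBox` loses this), with its box corollary
# `fine_mem_Icc_of_runX_mem_Icc_signed`.  These turn `R v ∈ region k / last core` (run frame `R = runX φ c₀ n h 1`) into the footprint rooms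
# `hreg₂ / hlast₂` of `reachOblAtHN_of_schedules₂SG₂` (C-A1).

builds on p205010 (kernel theorem, internal audit signed; external expert review pending) — nothing in this file uses p205010; nothing here is a
claim about the open node `SamePDropOfSkeletonNeg`.
Lane `prim-bschramm`, seat `prim-bschramm-p5` (gen 8; (C) lineage; C-FUNNEL.md §3 rooms); helper file (`--supports stmt-CriticalPhenomena-4575`).
[cite: KozmaNitzan2024, §4 p. 26 (Q_v, M_v, H_{v,x}), Lemma 12 (pp. 23–25)] [cite: MartineauTassion2017, §4.1]
-/

noncomputable section

namespace Summit.CriticalPhenomena.PercolationContinuityZ3.Theorems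

namespace Transplant

open Literature.Probability.Percolation Literature.Probability.LatticeModels SimpleGraph GadgetSystem Contour
open Literature.Probability.Percolation.KozmaNitzan
open Literature.Probability.Percolation.KozmaNitzan.Cells (oth oth_ne sgOf sgOf_sign stepVec_apply_fst stepVec_apply_oth eq_oth_of_ne oth_oth)
open PCells (mem_psBox_iff)

/-! ## §1 Planar level-form rooms of a corridor -/

namespace PCells2

variable (P : PCells2) {y : Site 2} {du : MDir} {z : Site 2}

/-- **`z ∈ H_{y,du}`** from `5r∥ ≤ lev ≤ 22r∥` and `|z⊥ − cen⊥| ≤ 2r⊥`. [cite: KozmaNitzan2024, §4 p. 26 (H_{v,x})] -/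
theorem mem_Hfull_of_lev (h1 : 5 * (P.r du.1 : ℤ) ≤ P.lev du y z) (h2 : P.lev du y z ≤ 22 * (P.r du.1 : ℤ))
    (h3 : P.cen y (oth du.1) - 2 * (P.r (oth du.1) : ℤ) ≤ z (oth du.1)) (h4 : z (oth du.1) ≤ P.cen y (oth du.1) + 2 * (P.r (oth du.1) : ℤ)) :
    z ∈ P.Hfull y du := by
  rw [Hfull, mem_psBox_iff]
  rw [lev_def] at h1 h2
  exact ⟨⟨h1, h2⟩, h3, h4⟩

/-- **`z ∈ Q_y ∪ H_{y,du}`** from `−5r∥ ≤ lev ≤ 22r∥` and `|z⊥ − cen⊥| ≤ 2r⊥` (the cube up to level `5r∥`, the corridor beyond).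
[cite: KozmaNitzan2024, §4 p. 26 (Q_v, H_{v,x})] -/
theorem mem_Q_union_Hfull_of_lev (h1 : -(5 * (P.r du.1 : ℤ)) ≤ P.lev du y z) (h2 : P.lev du y z ≤ 22 * (P.r du.1 : ℤ))
    (h3 : P.cen y (oth du.1) - 2 * (P.r (oth du.1) : ℤ) ≤ z (oth du.1)) (h4 : z (oth du.1) ≤ P.cen y (oth du.1) + 2 * (P.r (oth du.1) : ℤ)) :
    z ∈ P.Q y ∪ P.Hfull y du := by
  by_cases hl : 5 * (P.r du.1 : ℤ) ≤ P.lev du y z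
  · exact Finset.mem_union_right _ (P.mem_Hfull_of_lev hl h2 h3 h4)
  · push Not at hl
    refine Finset.mem_union_left _ ?_
    rw [Q, mem_abox_iff]
    intro i
    push_cast
    by_cases hi : i = du.1
    · subst hi
      rw [lev_def] at h1 hl
      rcases sgOf_sign du with hs | hs <;> rw [hs] at h1 hl <;> constructor <;> linarith
    · rw [eq_oth_of_ne hi]
      have := P.r (oth du.1)
      constructor <;> linarith [Int.natCast_nonneg (P.r (oth du.1))]

/-- **The unit box of `z` lies in `M_{y+du}`** from `17r∥ + 1 ≤ lev ≤ 23r∥ − 1` and `|z⊥ − cen⊥| ≤ 3r⊥ − 1`. [cite: KozmaNitzan2024, §4 p. 26 (M_v)] -/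
theorem Icc_unit_subset_M_add_of_lev (h1 : 17 * (P.r du.1 : ℤ) + 1 ≤ P.lev du y z) (h2 : P.lev du y z ≤ 23 * (P.r du.1 : ℤ) - 1)
    (h3 : P.cen y (oth du.1) - 3 * (P.r (oth du.1) : ℤ) + 1 ≤ z (oth du.1)) (h4 : z (oth du.1) ≤ P.cen y (oth du.1) + 3 * (P.r (oth du.1) : ℤ) - 1) :
    Finset.Icc (z - 1) (z + 1) ⊆ P.M (y + stepVec du) := by
  intro x hx
  rw [Finset.mem_Icc, Pi.le_def, Pi.le_def] at hx
  obtain ⟨hxl, hxu⟩ := hx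
  rw [M, mem_abox_iff]
  intro i
  push_cast
  by_cases hi : i = du.1
  · subst hi
    rw [lev_def] at h1 h2
    have hl := hxl du.1; have hu := hxu du.1
    simp only [Pi.sub_apply, Pi.add_apply, Pi.one_apply] at hl hu
    rw [cen_add_stepVec_fst]
    rcases sgOf_sign du with hs | hs <;> rw [hs] at h1 h2 ⊢ <;> constructor <;> linarith
  · rw [eq_oth_of_ne hi, cen_add_stepVec_oth]
    have hl := hxl (oth du.1); have hu := hxu (oth du.1)
    simp only [Pi.sub_apply, Pi.add_apply, Pi.one_apply] at hl hu
    constructor <;> linarith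

end PCells2

/-! ## §2 The signed off-centre reading of a run box into the fine cell map -/

namespace Skelφ

open TwoAxis.Para (modulus)

variable {V : Type} {G : SimpleGraph V} {φ : V → Site 2}

/-- **An off-centre run box read into the fine cell map, SIGNED form**: for `runX φ c₀ n h 1 v ∈ Icc lo hi` (`lo 0 ≤ Δα ≤ hi 0`, `b₁ := U·lo 1 ≤ Δβ′ ≤
U·hi 1 + U − 1 =: b₂`), `⌊c₀'(A(m·lo 0 − max(vα b₁, vα b₂))/n)/D⌋ ≤ Δρ₀ ≤ ⌊c₀'(A(m·hi 0 − min(vα b₁, vα b₂))/n)/D⌋ + 1` and `⌊c₁'A b₁/D⌋ ≤ Δρ₁ ≤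
⌊c₁'A b₂/D⌋ + 1` (fine positions relative to that of `c₀`) — the `m·α − vα·β′` cancellation kept. [cite: MartineauTassion2017, §4.1]
[cite: KozmaNitzan2024, §4 Lemma 11 (p. 22)] -/
theorem fine_sub_bounds_of_runX_mem_Icc_signed (t₀ : V) {A : ℤ} (hA : 0 ≤ A) {n : ℕ} (hn : 1 ≤ n) {h vα vβ : ℤ} (hm : 0 ≤ modulus n h vα vβ)
    {c₀' c₁' s₀ s₁ D : ℤ} (hc₀ : 0 ≤ c₀') (hc₁ : 0 ≤ c₁') (hD : 0 < D) (c₀ : V) {lo hi : Site 2} {v : V} (hv : runX φ c₀ n h 1 v ∈ Finset.Icc lo hi) :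
    ((c₀' * (A * (modulus n h vα vβ * lo 0 - max (vα * ((shearUnit n h : ℤ) * lo 1)) (vα * ((shearUnit n h : ℤ) * hi 1 + shearUnit n h - 1))) / n)) / D ≤
        fineSkel φ t₀ A n h vα vβ c₀' c₁' s₀ s₁ D v 0 - fineSkel φ t₀ A n h vα vβ c₀' c₁' s₀ s₁ D c₀ 0 ∧
      fineSkel φ t₀ A n h vα vβ c₀' c₁' s₀ s₁ D v 0 - fineSkel φ t₀ A n h vα vβ c₀' c₁' s₀ s₁ D c₀ 0 ≤
        (c₀' * (A * (modulus n h vα vβ * hi 0 - min (vα * ((shearUnit n h : ℤ) * lo 1)) (vα * ((shearUnit n h : ℤ) * hi 1 + shearUnit n h - 1))) / n)) / D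
          + 1) ∧
    ((c₁' * (A * ((shearUnit n h : ℤ) * lo 1))) / D ≤
        fineSkel φ t₀ A n h vα vβ c₀' c₁' s₀ s₁ D v 1 - fineSkel φ t₀ A n h vα vβ c₀' c₁' s₀ s₁ D c₀ 1 ∧
      fineSkel φ t₀ A n h vα vβ c₀' c₁' s₀ s₁ D v 1 - fineSkel φ t₀ A n h vα vβ c₀' c₁' s₀ s₁ D c₀ 1 ≤
        (c₁' * (A * ((shearUnit n h : ℤ) * hi 1 + shearUnit n h - 1))) / D + 1) := by
  obtain ⟨ha1, ha2, hb1, hb2⟩ := run_signed_bounds_of_mem_Icc hn c₀ h hv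
  have e0 : ∀ w : V, fineSkel φ t₀ A n h vα vβ c₀' c₁' s₀ s₁ D w 0 = coarseSkel φ t₀ A n h vα vβ c₀' s₀ s₁ D w 0 := fun w => rfl
  have e1 : ∀ w : V, fineSkel φ t₀ A n h vα vβ c₀' c₁' s₀ s₁ D w 1 = coarseSkel φ t₀ A n h vα vβ c₁' s₀ s₁ D w 1 := fun w => rfl
  rw [e0, e0, e1, e1]
  exact ⟨coarseSkel_zero_sub_bounds_signed hA hn hm hc₀ hD t₀ c₀ v ha1 ha2 hb1 hb2,
    coarseSkel_one_sub_bounds hA n h vα vβ hc₁ hD t₀ c₀ v hb1 hb2⟩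

/-- **… box form**: `runX φ c₀ n h 1 v ∈ Icc lo hi ⇒ fineSkel v ∈ Icc LO HI` for any fine box `[LO, HI]` containing `fineSkel c₀ +` the signed readings.
[cite: KozmaNitzan2024, §4 Lemma 12 (pp. 23–25)] -/
theorem fine_mem_Icc_of_runX_mem_Icc_signed (t₀ : V) {A : ℤ} (hA : 0 ≤ A) {n : ℕ} (hn : 1 ≤ n) {h vα vβ : ℤ} (hm : 0 ≤ modulus n h vα vβ)
    {c₀' c₁' s₀ s₁ D : ℤ} (hc₀ : 0 ≤ c₀') (hc₁ : 0 ≤ c₁') (hD : 0 < D) (c₀ : V) {lo hi LO HI : Site 2}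
    (hLO0 : LO 0 ≤ fineSkel φ t₀ A n h vα vβ c₀' c₁' s₀ s₁ D c₀ 0 +
      (c₀' * (A * (modulus n h vα vβ * lo 0 - max (vα * ((shearUnit n h : ℤ) * lo 1)) (vα * ((shearUnit n h : ℤ) * hi 1 + shearUnit n h - 1))) / n)) / D)
    (hHI0 : fineSkel φ t₀ A n h vα vβ c₀' c₁' s₀ s₁ D c₀ 0 +
      (c₀' * (A * (modulus n h vα vβ * hi 0 - min (vα * ((shearUnit n h : ℤ) * lo 1)) (vα * ((shearUnit n h : ℤ) * hi 1 + shearUnit n h - 1))) / n)) / D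
        + 1 ≤ HI 0)
    (hLO1 : LO 1 ≤ fineSkel φ t₀ A n h vα vβ c₀' c₁' s₀ s₁ D c₀ 1 + (c₁' * (A * ((shearUnit n h : ℤ) * lo 1))) / D)
    (hHI1 : fineSkel φ t₀ A n h vα vβ c₀' c₁' s₀ s₁ D c₀ 1 + (c₁' * (A * ((shearUnit n h : ℤ) * hi 1 + shearUnit n h - 1))) / D + 1 ≤ HI 1)
    {v : V} (hv : runX φ c₀ n h 1 v ∈ Finset.Icc lo hi) :
    fineSkel φ t₀ A n h vα vβ c₀' c₁' s₀ s₁ D v ∈ Finset.Icc LO HI := by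
  obtain ⟨⟨h0l, h0u⟩, h1l, h1u⟩ := fine_sub_bounds_of_runX_mem_Icc_signed (s₀ := s₀) (s₁ := s₁) t₀ hA hn hm hc₀ hc₁ hD c₀ hv
  rw [Finset.mem_Icc, Pi.le_def, Pi.le_def, Fin.forall_fin_two, Fin.forall_fin_two]
  exact ⟨⟨by linarith, by linarith⟩, by linarith, by linarith⟩

end Skelφ

end Transplant

end Summit.CriticalPhenomena.PercolationContinuityZ3.Theorems

end
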